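import Summits.NavierStokesRegularity.NavierStokesRegularity.Theorems.PalasekTowerBreakdownHeredityFromTwoOrBreakdown

/-! # CANDIDATE skeleton v4 for the split child `HeredityFromTwo` (item stmt-NavierStokesRegularity-19250) — NOT registered

Offered by the stub-worker ns-palasek-19250-p2 (g2) to the lead of record / planner g20 (re-cuts are the LEAD's call;
registering REPLACES the item's stub list — do not `skeleton check` this file unless you mean it). Five-stub cut under
the CURRENT item (no restatement needed): the v3 upper stub `stub_apriori_ceiling : AprioriCeiling` is split LOSSLESSLY
(`aprioriCeiling_iff_noPrematureBreakdown_and_windowCeiling`, p473580) into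

* `stub_no_premature_breakdown : ∀ k ≥ 2, NoPrematureBreakdownAt k` — «no registered level-`k` design's flow dies inside
  window `k`». ITS FALSITY IS FEFFERMAN'S (C) (`navierStokesBreakdownR3_of_not_noPrematureBreakdownAt`, p473253): a
  disprover's `stub_no_premature_breakdown_false` would prove the summit, so this stub is NOT a kill path of the route;
* `stub_window_ceiling : ∀ k ≥ 2, WindowCeilingAt k` — no SURVIVING registered flow overshoots `c₂ Y_{k+1}` on the window
  (the genuine NS content of the upper half);

and the three `k`-uniform floor stubs of v3 are kept VERBATIM. `stub_apriori_ceiling` and `stub_readout_floors` are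
DERIVED; `HeredityFromTwo_of : AprioriCeiling → ReadoutFloors → crux` (named heads, as the skeleton audit requires) and
`HeredityFromTwo_skeleton` are v3's. Under a planner RESTATEMENT of the item to `HeredityOrBreakdownFrom 2` (lossless for
`closes`: `Theorems.palasekTowerBreakdown_breakdownR3_of_base_heredityAtOne_orBreakdownFrom_two`, p473734) the first stub
simply disappears (`Theorems.palasekTowerBreakdown_orBreakdownFrom_two_of_windowCeiling_floors3`).
WHAT THIS IS NOT: not NS; nothing decided; five `sorry`s = five stubs. -/

namespace Summit.NavierStokesRegularity.FluidComputer.PalasekTowerClayBridge.BirthHeredityFromTwo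

open Summit.NavierStokesRegularity.NavierStokesRegularity

/-- candidate stub (upper half, clause 1/2, `k`-uniform): NO PREMATURE BREAKDOWN — every pinned rigid quiet wide design
with a registered stage at level `k ≥ 2` has a flow living classically with finite energy to `τ (k+1)`. «(C) if false»:
`navierStokesBreakdownR3_of_not_noPrematureBreakdownAt`. -/
theorem stub_no_premature_breakdown : ∀ k : ℕ, 2 ≤ k → NoPrematureBreakdownAt k := by
  sorry

/-- candidate stub (upper half, clause 2/2, `k`-uniform): the WINDOW CEILING — for every `k ≥ 2`, every surviving
registered flow (classical finite-energy solution of the design's system from the Clay datum on `[0, τ (k+1)]`) stays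
`≤ c₂ Y_{k+1}` on `[τ k, τ (k+1)]`. -/
theorem stub_window_ceiling : ∀ k : ℕ, 2 ≤ k → WindowCeilingAt k := by
  sorry

/-- registered stub of v3, verbatim (lower half, conjunct 1/3). -/
theorem stub_speed_floors : ∀ k : ℕ, 2 ≤ k → SpeedFloorAt k := by
  sorry

/-- registered stub of v3, verbatim (lower half, conjunct 2/3). -/
theorem stub_strain_floors : ∀ k : ℕ, 2 ≤ k → StrainFloorAt k := by
  sorry

/-- registered stub of v3, verbatim (lower half, conjunct 3/3). -/
theorem stub_core_floors : ∀ k : ℕ, 2 ≤ k → CoreFloorAt k := by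
  sorry

/-- v3's upper stub, now DERIVED from the two clauses (`aprioriCeiling_iff_noPrematureBreakdown_and_windowCeiling`). -/
theorem stub_apriori_ceiling : AprioriCeiling :=
  aprioriCeiling_iff_noPrematureBreakdown_and_windowCeiling.2 ⟨stub_no_premature_breakdown, stub_window_ceiling⟩

/-- v2's lower stub, DERIVED from the three floor stubs (as in v3). -/
theorem stub_readout_floors : ReadoutFloors :=
  readoutFloors_iff_forall_floors.2 fun k hk =>
    ⟨stub_speed_floors k hk, stub_strain_floors k hk, stub_core_floors k hk⟩

/-- The composition (v3 verbatim): the child crux BY NAME from its two named halves. -/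
theorem HeredityFromTwo_of : AprioriCeiling → ReadoutFloors →
    Summit.NavierStokesRegularity.NavierStokesRegularity.Theses.PalasekTowerBreakdown.HeredityFromTwo :=
  fun hA hB => heredityFrom_two_of_aprioriCeiling_floors hA hB

/-- The hypothesis-free skeleton line: carries the five stubs' `sorry`s. -/
theorem HeredityFromTwo_skeleton :
    Summit.NavierStokesRegularity.NavierStokesRegularity.Theses.PalasekTowerBreakdown.HeredityFromTwo :=
  HeredityFromTwo_of stub_apriori_ceiling stub_readout_floors

/-- The same crux by the five-argument form (sanity; `Theorems.…_of_noPrematureBreakdown_windowCeiling_floors3`). -/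
theorem HeredityFromTwo_of_five :
    Summit.NavierStokesRegularity.NavierStokesRegularity.Theses.PalasekTowerBreakdown.HeredityFromTwo :=
  Theorems.palasekTowerBreakdown_heredityFromTwo_of_noPrematureBreakdown_windowCeiling_floors3
    stub_no_premature_breakdown stub_window_ceiling stub_speed_floors stub_strain_floors stub_core_floors

end Summit.NavierStokesRegularity.FluidComputer.PalasekTowerClayBridge.BirthHeredityFromTwo
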